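import Summits.Ventures.HSemireg.WedgeHankelFrameChange

/-!
# Venture HSemireg — THE HANKEL RANK OF A POLYNOMIAL CLASS from the confluent kernel law: `rank H_k(exp(λΘ)·Σ_{p≤P} q_p Θ^p/p!) = min(P, k) + 1`
# for `k ≤ n − P`, and THE BINOMIAL TRANSFORM PRESERVES EVERY HANKEL RANK — linear algebra read off THEOREM H and the frame change

HONEST FRAMING. Part of the Lean index of the computation cell `pub-hsemireg` (seat p10 gen 15, Sunday typer «UNIFORM-IN-n»).
Finite-dimensional EXTERIOR ALGEBRA over a field + ranks of Hankel matrices ONLY; no variety, no cohomology theory, no sheaf, no Ext group, no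
semiregularity map; nothing here says that HC / HC_CM / HC_AV holds; no Literature fact is declared or used.  Custodian versions as in
`WedgeHankelSiegelIdeal` (1/3) and `WedgeHankelConfluent`: FORMULA-N PART A §2.6 THEOREM H (`WedgeHankelModel.hankelLaw_model`:
`rank(θ ↦ θ ∧ w_n(q) ∣ ⋀^k) = C(n,k)·rank H_k(q)`); the dictionary (`exp(λΘ)·v` ↦ `expMul λ q`) is QUOTED, never asserted.

WHAT IS IN THE TREE / KEYED.  THEOREM H turns kernel dimensions into Hankel ranks; (3/3) the excess law; gen 14 computed the Hankel ranks of SECANT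
sequences by Vandermonde minors (`WedgeHankelSecantRank`); (10) the ranks of the powers `E_p` (`rank_hankel1_spike_eq_card`).  THIS FILE (continues
namespace `Summit.Ventures.HSemireg.Wedge.HankelSiegelIdeal`; imports gen 15's `WedgeHankelFrameChange`) reads two rank statements OFF the kernel laws,
with no matrix computation:
* §28 **`finrank_siegelIdeal_sup_xRich`: `dim (SI_k ⊔ xRich(k, P)) + (min(P,k) + 1)·C(n,k) = C(2n,k)`** (`k ≤ n`; (9)'s block bookkeeping
  `finrank_sup_eq_sum` + (5)'s isotropic dimensions + Vandermonde).
* §29 **THE CONFLUENT RANK LAW `rank_hankel1_of_order`: `rank H_k(q) = min(P, k) + 1`** for `q` supported on `[0, P]` with `q_P ≠ 0` and `k + P ≤ n`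
  (the anti-triangular catalecticant of a polynomial class; `finrank_Kr_w_of_order`: `dim Kr + (min(P,k)+1)·C(n,k) = C(2n,k)`); the tangent class
  `A + BΘ` has Hankel rank `2` in every degree `1 ≤ k ≤ n − 1` (`rank_hankel1_tangent`).
* §30 **THE BINOMIAL TRANSFORM PRESERVES HANKEL RANKS: `rank_hankel1_expMul`: `rank H_k(expMul λ q) = rank H_k(q)` for EVERY `q`, `λ`, `k`** (from the
  frame change: kernels are transported, THEOREM H both sides; classically `H(expMul λ q) = L_λ H(q) L_λᵀ` with Pascal matrices — not computed here), and
  so **`rank_hankel1_expMul_of_order`: `rank H_k(exp(λΘ)·(order-P polynomial)) = min(P,k) + 1`** at every node `λ`.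
NOT typed: ranks in the degrees `k > n − P`; several nodes; anything Ext-side.  Class side only.
-/

open Module

namespace Summit.Ventures.HSemireg.Wedge.HankelSiegelIdeal

open Summit.Ventures.HSemireg.Wedge Summit.Ventures.HSemireg.Wedge.Kunneth Summit.Ventures.HSemireg.Wedge.Hankel
  Summit.Ventures.HSemireg.Wedge.HankelSiegel Summit.Ventures.HSemireg.Wedge.KunnethKernel Summit.Ventures.HSemireg.Wedge.HankelFrameChange

variable (K : Type*) [Field K] {n : ℕ}

/-! ## §28. The dimension of `SI_k ⊔ xRich(k, P)` -/

/-- the block family of `SI_k ⊔ xRich(k, P)`: isotropic parts up to `x`-count `P`, whole blocks beyond. -/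
noncomputable def cblock (n k P a : ℕ) : Submodule K (HT K (In n)) :=
  if a ≤ P then plane K n a (k - a) ⊓ siegelIdeal K n k else plane K n a (k - a)

/-- each block of the family lies in its plane. -/
lemma cblock_le_plane (k P a : ℕ) : cblock K n k P a ≤ plane K n a (k - a) := by
  unfold cblock; split_ifs
  · exact inf_le_left
  · exact le_rfl

/-- **`SI_k ⊔ xRich(k, P)` block by block**: `= Σ_{a ≤ k} cblock(a)`. -/
theorem siegelIdeal_sup_xRich_eq_sup (k P : ℕ) :
    siegelIdeal K n k ⊔ xRich K n k P = (Finset.range (k + 1)).sup (cblock K n k P) := by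
  apply le_antisymm
  · refine sup_le ?_ ?_
    · rw [siegelIdeal_eq_sup_blocks' K (n := n) k]
      refine Finset.sup_le fun a ha => ?_
      refine le_trans ?_ (Finset.le_sup (f := cblock K n k P) ha)
      unfold cblock; split_ifs
      · exact le_rfl
      · exact inf_le_left
    · refine iSup₂_le fun a ha => ?_
      rw [Finset.mem_Ioc] at ha
      have hmem : a ∈ Finset.range (k + 1) := Finset.mem_range.mpr (by omega)
      have e : cblock K n k P a = plane K n a (k - a) := if_neg (by omega)
      exact le_trans e.symm.le (Finset.le_sup (f := cblock K n k P) hmem)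
  · refine Finset.sup_le fun a ha => ?_
    rw [Finset.mem_range] at ha
    unfold cblock; split_ifs with h
    · exact inf_le_right.trans le_sup_left
    · exact (plane_le_xRich K (by omega) (by omega)).trans le_sup_right

/-- dimensions of the blocks: `C(n,a)C(n,k−a) − C(n,k)` for `a ≤ P`, `C(n,a)C(n,k−a)` beyond (`a ≤ k`). -/
lemma finrank_cblock_add {k P a : ℕ} (ha : a ≤ k) :
    finrank K (cblock K n k P a) + (if a ≤ P then n.choose k else 0) = n.choose a * n.choose (k - a) := by
  by_cases h : a ≤ P
  · have e : cblock K n k P a = plane K n a (k - a) ⊓ siegelIdeal K n k := if_pos h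
    have := finrank_plane_inf_siegelIdeal K (n := n) a (k - a)
    rw [show a + (k - a) = k by omega] at this
    rw [e, if_pos h]; exact this
  · have e : cblock K n k P a = plane K n a (k - a) := if_neg h
    rw [e, if_neg h, add_zero, finrank_plane]

/-- `Σ_{a ≤ k} [a ≤ P]·C(n,k) = (min(P,k) + 1)·C(n,k)`. -/
lemma sum_ite_le_eq (k P : ℕ) : ∑ a ∈ Finset.range (k + 1), (if a ≤ P then n.choose k else 0) = (min P k + 1) * n.choose k := by
  rw [Finset.sum_ite, Finset.sum_const_zero, add_zero, Finset.sum_const, smul_eq_mul]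
  congr 1
  have : (Finset.range (k + 1)).filter (fun a => a ≤ P) = Finset.range (min P k + 1) := by
    ext a; simp only [Finset.mem_filter, Finset.mem_range]; omega
  rw [this, Finset.card_range]

/-- **`dim (SI_k ⊔ xRich(k, P)) + (min(P,k) + 1)·C(n,k) = C(2n,k)`** (`k ≤ n` not needed: Vandermonde in range form). -/
theorem finrank_siegelIdeal_sup_xRich (k P : ℕ) :
    finrank K ↥(siegelIdeal K n k ⊔ xRich K n k P) + (min P k + 1) * n.choose k = (n + n).choose k := by
  rw [siegelIdeal_sup_xRich_eq_sup, finrank_sup_eq_sum K _ (fun a => k - a) _ (cblock_le_plane K k P), ← sum_ite_le_eq,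
    ← Finset.sum_add_distrib, ← sum_choose_mul_choose (n := n) k]
  exact Finset.sum_congr rfl fun a ha => finrank_cblock_add K (by rw [Finset.mem_range] at ha; omega)

/-! ## §29. The Hankel rank of a class of order `P` at the node `0` -/

/-- th-7's two wedge maps agree (definitional). -/
lemma hankel_wedge_eq (k : ℕ) (x : HT K (In n)) : Hankel.wedge K n k x = Kunneth.wedge K (In n) k x := rfl

/-- `dim ker(θ ↦ θ ∧ f ∣ ⋀^k) = dim Kr(univ, f, k)`. -/
lemma finrank_ker_wedge_eq_finrank_Kr (k : ℕ) (f : HT K (In n)) :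
    finrank K (LinearMap.ker (Hankel.wedge K n k f)) = finrank K (Kr K Finset.univ f k) := by
  rw [hankel_wedge_eq, ker_wedge_eq_comap_Kr,
    (Submodule.comapSubtypeEquivOfLe ((Kr_le_Hom K Finset.univ f k).trans (KunnethKernel.Hom_univ_eq_exteriorPower K k).le)).finrank_eq]

/-- **THEOREM H as a kernel count: `dim Kr(univ, w_n(q), k) + C(n,k)·rank H_k(q) = C(2n,k)`** for every `q`, `k`. -/
theorem finrank_Kr_w_add_rank (k : ℕ) (q : ℕ → K) :
    finrank K (Kr K Finset.univ (w K n n q) k) + n.choose k * (hankel1 K n k q).rank = (n + n).choose k := by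
  rw [← finrank_ker_wedge_eq_finrank_Kr, ← hankelLaw_model, add_comm, LinearMap.finrank_range_add_finrank_ker, finrank_exteriorPower]

/-- **`dim Kr(univ, w_n(q), k) + (min(P,k) + 1)·C(n,k) = C(2n,k)`** for `q` supported on `[0, P]`, `q_P ≠ 0`, `k + P ≤ n`. -/
theorem finrank_Kr_w_of_order {k P : ℕ} (hkP : k + P ≤ n) {q : ℕ → K} (hq : ∀ j, P < j → q j = 0) (hqP : q P ≠ 0) :
    finrank K (Kr K Finset.univ (w K n n q) k) + (min P k + 1) * n.choose k = (n + n).choose k := by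
  rw [Kr_w_eq_of_order K hkP hq hqP, finrank_siegelIdeal_sup_xRich]

/-- **THE CONFLUENT RANK LAW: `rank H_k(q) = min(P, k) + 1`** for `q` supported on `[0, P]` with `q_P ≠ 0` and `k + P ≤ n` — the catalecticant of a
polynomial class is anti-triangular with `min(P,k) + 1` non-zero rows (read off the kernel law and THEOREM H; no matrix computation). -/
theorem rank_hankel1_of_order {k P : ℕ} (hkP : k + P ≤ n) {q : ℕ → K} (hq : ∀ j, P < j → q j = 0) (hqP : q P ≠ 0) :
    (hankel1 K n k q).rank = min P k + 1 := by
  have h1 := finrank_Kr_w_add_rank K (n := n) k q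
  have h2 := finrank_Kr_w_of_order K hkP hq hqP
  have hpos : 0 < n.choose k := Nat.choose_pos (by omega)
  have h3 : n.choose k * (hankel1 K n k q).rank = n.choose k * (min P k + 1) := by
    rw [mul_comm (n.choose k) (min P k + 1)]; omega
  exact Nat.eq_of_mul_eq_mul_left hpos h3

/-- **THE TANGENT CLASS HAS HANKEL RANK `2`: `rank H_k(A, B, 0, 0, …) = 2`** for `B ≠ 0` and `1 ≤ k ≤ n − 1` (and `1` in degree `0`). -/
theorem rank_hankel1_tangent {k : ℕ} (hk : k + 1 ≤ n) (A : K) {B : K} (hB : B ≠ 0) :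
    (hankel1 K n k (fun j => if j = 0 then A else if j = 1 then B else 0)).rank = min 1 k + 1 :=
  rank_hankel1_of_order K hk
    (fun j hj => by
      show (if j = 0 then A else if j = 1 then B else 0) = 0
      rw [if_neg (by omega), if_neg (by omega)])
    (by
      show (if (1 : ℕ) = 0 then A else if (1 : ℕ) = 1 then B else 0) ≠ 0
      rw [if_neg (by omega), if_pos rfl]; exact hB)

/-! ## §30. The binomial transform preserves Hankel ranks -/

/-- a Hankel matrix with no columns (`k > n`) has rank `0`. -/
lemma rank_hankel1_eq_zero_of_lt {k : ℕ} (hk : n < k) (q : ℕ → K) : (hankel1 K n k q).rank = 0 := by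
  have h := Matrix.rank_le_width (hankel1 K n k q)
  have h0 : n + 1 - k = 0 := by omega
  omega

/-- **THE BINOMIAL TRANSFORM PRESERVES EVERY HANKEL RANK: `rank H_k(expMul λ q) = rank H_k(q)`** for every field, `n`, `k`, `λ` and `q`
(the frame change transports the kernel of `θ ↦ θ ∧ w_n(q)`; THEOREM H on both sides). -/
theorem rank_hankel1_expMul (lam : K) (k : ℕ) (q : ℕ → K) : (hankel1 K n k (expMul K lam q)).rank = (hankel1 K n k q).rank := by
  by_cases hk : k ≤ n
  · have h1 := finrank_Kr_w_add_rank K (n := n) k q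
    have h2 := finrank_Kr_w_add_rank K (n := n) k (expMul K lam q)
    rw [finrank_Kr_w_expMul] at h2
    have hpos : 0 < n.choose k := Nat.choose_pos hk
    exact Nat.eq_of_mul_eq_mul_left hpos (by omega)
  · rw [rank_hankel1_eq_zero_of_lt K (by omega), rank_hankel1_eq_zero_of_lt K (by omega)]

/-- **THE CONFLUENT RANK LAW AT EVERY NODE: `rank H_k(expMul λ q) = min(P, k) + 1`** for `q` supported on `[0, P]`, `q_P ≠ 0`, `k + P ≤ n` — the class
`exp(λΘ)·(polynomial of degree P)`. -/
theorem rank_hankel1_expMul_of_order (lam : K) {k P : ℕ} (hkP : k + P ≤ n) {q : ℕ → K} (hq : ∀ j, P < j → q j = 0) (hqP : q P ≠ 0) :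
    (hankel1 K n k (expMul K lam q)).rank = min P k + 1 := by
  rw [rank_hankel1_expMul, rank_hankel1_of_order K hkP hq hqP]

/-- images: **`dim V(univ, w_n(expMul λ q), k) = dim V(univ, w_n(q), k)`** — multiplying by `exp(λΘ)` changes no wedge rank. -/
theorem finrank_V_w_expMul (lam : K) (k : ℕ) (q : ℕ → K) :
    finrank K (V K (In n) Finset.univ (w K n n (expMul K lam q)) k) = finrank K (V K (In n) Finset.univ (w K n n q) k) := by
  rw [V_w_expMul]; exact (Φs K (n := n) lam).toLinearEquiv.finrank_map_eq _

end Summit.Ventures.HSemireg.Wedge.HankelSiegelIdeal
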